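import Literature.Geometry.Kaehler.GradedFormsIsotypicProjectionsAgree
import Literature.Geometry.Kaehler.ComplexTorusNeronSeveriLieAlgebraDefinedOverQ
import HarnessLib

/-!
# The centre of the Lefschetz algebra `ℚ[L, Λ]` — the weight operators `T_f` and the isotypic projections `P_a` —
# consists of rational operators stabilising Looijenga–Lunts' Hodge algebra `Hdg(X)` and the Hodge classes

[topic Geometry/Kaehler] Layer `Literature/Geometry/Kaehler`, namespace `Literature.Geometry.Kaehler.ComplexTorus`; lane
`lit-hodgefound`, seat p09, generation 23, row g23-#3 (THEOREMS ONLY, no definition, no named fact). A junction, BY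
NAME, of two vocabularies of the tree for the complex torus `X = E/Φ(ℤ^ι)` (`g = dim_ℂ E`, total carrier
`GForm E ℂ = ⊕ₖ Hᵏ(X, ℂ)`):
* the LEFSCHETZ `𝔰𝔩₂` thread (p08/p09): the weight operators `T_f = Σ_{m ≤ 2g} single m ∘ (Σ_r f(m-2r) π_{m,r}) ∘ proj m`
  of the centre `Z(ℂ[L, Λ]) = ℬ ∩ 𝒜` (g20-#2 `GradedFormsLefschetzCentre`, Goodman–Wallach Cor. 4.2.4 (2)), the
  isotypic projections `E_a = T_{𝟙_a}` (g20-#3) `=` the matrix-unit sums `P_a = isotypicProj η a` (g22-#2/#3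
  `GradedFormsHoweDuality`, `GradedFormsIsotypicProjectionsAgree`), and their rationality / bidegree `(0,0)`
  (g21-#2 `GradedFormsWeightOperatorsHodge`: `sum_single_smul_primitiveProj_apply_mem_rationalForms`,
  `…_mem_typeSubmodule`, `…_mem_hodgeClasses`; g22-#3 `isotypicProj_apply_mem_rationalForms`, `…_typeSubmodule`,
  `…_hodgeClasses`);
* skel-1's LOOIJENGA–LUNTS thread (A1-60 `ComplexTorusNeronSeveriLieAlgebraDefinedOverQ`): the `ℚ`-algebra
  `rationalEnd Φ = 𝔤𝔩(H•(X; ℚ))` of `ℂ`-linear operators on `H•(X; ℂ)` mapping `H•(X; ℚ) = rationalFormsG Φ` into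
  itself, the Hodge algebra `Hdg(X) = hodgeAlgebraG Φ` (complex span of the rational `(k,k)`-classes), its stabiliser
  `hodgeAlgebraEnd Φ`, and the `ℚ`-space of all Hodge classes `hodgeClassesG Φ` — there it is proved that `e_η = L`,
  `f_η = Λ` and hence `𝔤_NS(X)` lie in `rationalEnd Φ` and `hodgeAlgebraEnd Φ`.

## Sources, verbatim

J. S. Milne, *Lefschetz classes on abelian varieties* (1999), §5 p. 665 (proof of Thm. 5.9): "all elements of the
`ℚ`-algebra `ℚ[L, Λ]` are Lefschetz. Since this algebra contains `ᶜΛ` and `∗` (Kleiman 1968, 1.4.4) …" — in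
particular every element of `ℚ[L, Λ]` is an endomorphism of `H•(X, ℚ)` preserving the Hodge classes.
E. Looijenga, V. Lunts, *A Lie algebra attached to a projective variety* (1997), §1 (1.7) p. 6: "`M` … and the
action of `𝔞` on `M` are defined over `ℚ` … `𝔤(𝔞, M)` is as a Lie subalgebra of `𝔤𝔩(M)` also defined over `ℚ`",
§3 p. 16: "the Hodge algebra `Hdg(X) ⊂ H(X)` (i.e., the complex span of the rational part of `⊕_k H^{k,k}(X)`) is
`𝔤_NS(X)`-invariant". C. Voisin, *Hodge Theory and Complex Algebraic Geometry I* (2002), §6.2.3 Rem. 6.27 ("the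
operator `L` is of bidegree `(1,1)` … compatible with the Hodge decomposition"), Ch. 7 intro p. 131 ("a
decomposition as a direct sum of rational sub-Hodge structures … when the operator `L` preserves the rational
cohomology"). R. Goodman, N. R. Wallach, GTM 255, §4.2.1 Cor. 4.2.4 (2) (the centre `𝒜 ∩ ℬ` acts by scalars on the
isotypic components; every function on the spectrum is realised), §5.5.1 Cor. 5.5.9 (5.54).

## What is proved (`η ∈ NS(X)` non-degenerate — every polarised torus / abelian variety; `f : ℕ → ℚ`; `a ≤ g`)

* **`sum_single_smul_primitiveProj_mem_rationalEnd`** — `T_f ∈ 𝔤𝔩(H•(X; ℚ))` (`rationalEnd Φ`): the centre of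
  `ℚ[L_η, Λ_η]` consists of rational operators (Milne's "all elements of the `ℚ`-algebra `ℚ[L, Λ]`").
* **`sum_single_smul_primitiveProj_apply_mem_hodgeClassesIn`** / `…_mem_hodgeClassesG` — `T_f` maps
  `H^m(X; ℚ) ∩ H^{p,p}` into itself, hence the `ℚ`-space of all Hodge classes `hodgeClassesG Φ` into itself.
* **`sum_single_smul_primitiveProj_mem_hodgeAlgebraEnd`** — `T_f(Hdg(X)) ⊆ Hdg(X)` (`hodgeAlgebraEnd Φ`; for any
  `f : ℕ → ℂ` the operator has bidegree `(0,0)`, and for rational `f` it is rational).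
* **`isotypicProj_mem_rationalEnd`**, **`isotypicProj_mem_hodgeAlgebraEnd`**, `isotypicProj_apply_mem_hodgeClassesIn`,
  `isotypicProj_apply_mem_hodgeClassesG` — the same for the isotypic projections `P_a` of the `(Sp(E, η), 𝔰𝔩₂)`
  duality: the decomposition `H•(X; ℚ) = ⊕ₐ P_a H•(X; ℚ)`, `Hdg(X) = ⊕ₐ P_a Hdg(X)` is by RATIONAL projectors
  STABILISING THE HODGE ALGEBRA (Voisin's "direct sum of rational sub-Hodge structures").
* `isotypicProj_mem_rationalEnd_and_mem_hodgeAlgebraEnd` (both memberships at once) and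
  `eq_sum_isotypicProj_of_mem_hodgeAlgebraG` (`w = Σ_{a ≤ g} P_a w` inside `Hdg(X)`) — glue for consumers.

## References

* [cite: Milne1999LefschetzClasses, §5 p. 665 (proof of Thm. 5.9), Rem. 5.11]
* [cite: LooijengaLunts1997, §1 (1.7); §3 p. 16]
* [cite: VoisinHodgeI2002, §6.2.3 Rem. 6.27; Ch. 7 introduction (p. 131); §7.1.2]
* [cite: GoodmanWallachGTM255, §4.2.1 Cor. 4.2.4 (2); §5.5.1 Cor. 5.5.9 (5.54)]
-/

noncomputable section

set_option maxSynthPendingDepth 3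

open Complex

namespace Literature.Geometry.Kaehler

namespace ComplexTorus

open Module Finset
open Literature.Analysis.Complex (typeSubmodule)
open Literature.LinearAlgebra.Alternating (GForm)
open Literature.LinearAlgebra.Alternating.GForm (of of_apply_self of_apply_of_ne)

variable {ι : Type*} [Fintype ι] {E : Type*} [NormedAddCommGroup E] [NormedSpace ℂ E] [FiniteDimensional ℂ E]
  (Φ : (ι → ℝ) ≃L[ℝ] E) {η : E [⋀^Fin 2]→L[ℝ] ℝ}

omit [Fintype ι] [FiniteDimensional ℂ E] Φ in
/-- The indicator weight `𝟙_a : ℕ → ℂ` of the isotypic projection is rational-valued (plumbing). [folklore] -/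
private theorem pi_single_one_eq_ratCast' (a n : ℕ) :
    (Pi.single a (1 : ℂ) : ℕ → ℂ) n = ((Pi.single a (1 : ℚ) : ℕ → ℚ) n : ℂ) := by
  rcases eq_or_ne n a with rfl | h
  · rw [Pi.single_eq_same, Pi.single_eq_same, Rat.cast_one]
  · rw [Pi.single_eq_of_ne h, Pi.single_eq_of_ne h, Rat.cast_zero]

/-! ## §1 The weight operators `T_f` of the centre of `ℚ[L, Λ]` -/

section WeightOperators

/-- **`T_f ∈ 𝔤𝔩(H•(X; ℚ))`** — the weight operators of the centre of the Lefschetz algebra with RATIONAL weights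
`f : ℕ → ℚ` (`η ∈ NS(X)` non-degenerate) are rational operators: they map `H•(X; ℚ) = rationalFormsG Φ` into itself
(g21-#2's degreewise `sum_single_smul_primitiveProj_apply_mem_rationalForms`, packaged in A1-60's `rationalEnd`).
[cite: Milne1999LefschetzClasses, §5 p. 665 (proof of Thm. 5.9)] [cite: LooijengaLunts1997, §1 (1.7)] -/
theorem sum_single_smul_primitiveProj_mem_rationalEnd (hη : IsNSForm Φ η)
    (hnd : ∀ v : E, v ≠ 0 → ∃ w : E, η ![v, w] ≠ 0) (f : ℕ → ℚ) :
    (∑ n ∈ Finset.range (2 * finrank ℂ E + 1),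
      LinearMap.single ℂ (fun n : ℕ ↦ E [⋀^Fin n]→L[ℝ] ℂ) n ∘ₗ
        (∑ r ∈ lefschetzRange (finrank ℂ E) n, ((f (n - 2 * r) : ℚ) : ℂ) • primitiveProj η n r) ∘ₗ
          LinearMap.proj (φ := fun n : ℕ ↦ E [⋀^Fin n]→L[ℝ] ℂ) n) ∈ rationalEnd Φ := by
  intro w hw
  rw [mem_rationalFormsG_iff] at hw ⊢
  exact sum_single_smul_primitiveProj_apply_mem_rationalForms Φ hη hnd f hw

/-- **`T_f` maps `H^m(X; ℚ) ∩ H^{p,p}` into itself** (rational weights; `T_f` is rational and of bidegree `(0,0)`).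
[cite: VoisinHodgeI2002, §6.2.3 Rem. 6.27] [cite: Milne1999LefschetzClasses, §5 p. 665 (proof of Thm. 5.9)] -/
theorem sum_single_smul_primitiveProj_apply_mem_hodgeClassesIn (hη : IsNSForm Φ η)
    (hnd : ∀ v : E, v ≠ 0 → ∃ w : E, η ![v, w] ≠ 0) (f : ℕ → ℚ) {m p : ℕ} {γ : E [⋀^Fin m]→L[ℝ] ℂ}
    (hγ : γ ∈ hodgeClassesIn Φ m p) :
    (∑ n ∈ Finset.range (2 * finrank ℂ E + 1),
      LinearMap.single ℂ (fun n : ℕ ↦ E [⋀^Fin n]→L[ℝ] ℂ) n ∘ₗ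
        (∑ r ∈ lefschetzRange (finrank ℂ E) n, ((f (n - 2 * r) : ℚ) : ℂ) • primitiveProj η n r) ∘ₗ
          LinearMap.proj (φ := fun n : ℕ ↦ E [⋀^Fin n]→L[ℝ] ℂ) n) (of m γ) m ∈ hodgeClassesIn Φ m p := by
  by_cases hpm : p + p = m
  · obtain ⟨hrat, htype⟩ := (mem_hodgeClassesIn_iff Φ).1 hγ
    refine (mem_hodgeClassesIn_iff Φ).2 ⟨?_, ?_⟩
    · refine sum_single_smul_primitiveProj_apply_mem_rationalForms Φ hη hnd f (fun n ↦ ?_) m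
      rcases eq_or_ne n m with rfl | h
      · rwa [of_apply_self]
      · rw [of_apply_of_ne h]; exact Submodule.zero_mem _
    · exact sum_single_smul_primitiveProj_apply_mem_typeSubmodule hη.type_one_one hnd (fun k ↦ ((f k : ℚ) : ℂ)) hpm
        (by rwa [of_apply_self])
  · rw [hodgeClassesIn_eq_bot_of_ne Φ hpm, Submodule.mem_bot] at hγ
    rw [hγ, Literature.LinearAlgebra.Alternating.GForm.of_zero, map_zero, Pi.zero_apply]
    exact Submodule.zero_mem _

/-- **`T_f` (rational weights) maps the `ℚ`-space of all Hodge classes `⊕ₘ ⊕ₚ (H^m(X; ℚ) ∩ H^{p,p})` into itself.**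
[cite: Milne1999LefschetzClasses, §5 p. 665 (proof of Thm. 5.9)] [cite: VoisinHodgeI2002, Ch. 7 introduction (p. 131)] -/
theorem sum_single_smul_primitiveProj_apply_mem_hodgeClassesG (hη : IsNSForm Φ η)
    (hnd : ∀ v : E, v ≠ 0 → ∃ w : E, η ![v, w] ≠ 0) (f : ℕ → ℚ) {w : GForm E ℂ} (hw : w ∈ hodgeClassesG Φ) :
    (∑ n ∈ Finset.range (2 * finrank ℂ E + 1),
      LinearMap.single ℂ (fun n : ℕ ↦ E [⋀^Fin n]→L[ℝ] ℂ) n ∘ₗ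
        (∑ r ∈ lefschetzRange (finrank ℂ E) n, ((f (n - 2 * r) : ℚ) : ℂ) • primitiveProj η n r) ∘ₗ
          LinearMap.proj (φ := fun n : ℕ ↦ E [⋀^Fin n]→L[ℝ] ℂ) n) w ∈ hodgeClassesG Φ := by
  set T := (∑ n ∈ Finset.range (2 * finrank ℂ E + 1),
      LinearMap.single ℂ (fun n : ℕ ↦ E [⋀^Fin n]→L[ℝ] ℂ) n ∘ₗ
        (∑ r ∈ lefschetzRange (finrank ℂ E) n, ((f (n - 2 * r) : ℚ) : ℂ) • primitiveProj η n r) ∘ₗ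
          LinearMap.proj (φ := fun n : ℕ ↦ E [⋀^Fin n]→L[ℝ] ℂ) n) with hT
  rw [mem_hodgeClassesG_iff] at hw ⊢
  intro m
  -- `(T w)_m` only depends on `w_m`: `(T w)_m = (T (of m (w m)))_m`
  have hdep : T w m = T (of m (w m)) m := by
    rw [hT, sum_single_comp_proj_apply_apply, sum_single_comp_proj_apply_apply, of_apply_self]
  rw [hdep]
  refine Submodule.iSup_induction (p := fun p ↦ hodgeClassesIn Φ m p)
    (motive := fun γ ↦ T (of m γ) m ∈ ⨆ p, hodgeClassesIn Φ m p) (hw m) (fun p γ hγ ↦ ?_) ?_ fun γ δ hγ hδ ↦ ?_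
  · exact Submodule.mem_iSup_of_mem p (hT ▸ sum_single_smul_primitiveProj_apply_mem_hodgeClassesIn Φ hη hnd f hγ)
  · rw [Literature.LinearAlgebra.Alternating.GForm.of_zero, map_zero]
    exact Submodule.zero_mem _
  · rw [Literature.LinearAlgebra.Alternating.GForm.of_add, map_add, Pi.add_apply]
    exact Submodule.add_mem _ hγ hδ

/-- **`T_f(Hdg(X)) ⊆ Hdg(X)`** — the weight operators of the centre of `ℚ[L, Λ]` with rational weights stabilise
Looijenga–Lunts' Hodge algebra (the complex span of the rational `(k,k)`-classes), i.e. lie in `hodgeAlgebraEnd Φ`: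
degree by degree `T_f` is a `ℂ`-linear map of `H^m(X; ℂ)` sending every Hodge class to a Hodge class.
[cite: LooijengaLunts1997, §3 p. 16] [cite: VoisinHodgeI2002, §6.2.3 Rem. 6.27; §7.1.2] -/
theorem sum_single_smul_primitiveProj_mem_hodgeAlgebraEnd (hη : IsNSForm Φ η)
    (hnd : ∀ v : E, v ≠ 0 → ∃ w : E, η ![v, w] ≠ 0) (f : ℕ → ℚ) :
    (∑ n ∈ Finset.range (2 * finrank ℂ E + 1),
      LinearMap.single ℂ (fun n : ℕ ↦ E [⋀^Fin n]→L[ℝ] ℂ) n ∘ₗ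
        (∑ r ∈ lefschetzRange (finrank ℂ E) n, ((f (n - 2 * r) : ℚ) : ℂ) • primitiveProj η n r) ∘ₗ
          LinearMap.proj (φ := fun n : ℕ ↦ E [⋀^Fin n]→L[ℝ] ℂ) n) ∈ hodgeAlgebraEnd Φ := by
  intro w hw
  rw [mem_hodgeAlgebraG_iff] at hw ⊢
  intro m
  rw [sum_single_comp_proj_apply_apply]
  refine map_hodgeSpan_le Φ (∑ r ∈ lefschetzRange (finrank ℂ E) m, ((f (m - 2 * r) : ℚ) : ℂ) • primitiveProj η m r)
    (fun p γ hγ ↦ ?_) ⟨w m, hw m, rfl⟩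
  have h := sum_single_smul_primitiveProj_apply_mem_hodgeClassesIn Φ hη hnd f hγ
  rw [sum_single_comp_proj_apply_apply, of_apply_self] at h
  exact mem_hodgeSpan_of_mem Φ h

end WeightOperators

/-! ## §2 The isotypic projections `P_a` of the `(Sp(E, η), 𝔰𝔩₂)` duality -/

section Isotypic

/-- **`P_a ∈ 𝔤𝔩(H•(X; ℚ))`** — the isotypic projections `P_a = Σₛ e^a_{ss}` (`a ≤ g`) of the Lefschetz algebra of a
non-degenerate `η ∈ NS(X)` are rational operators: the decomposition `H•(X; ℚ) = ⊕ₐ P_a H•(X; ℚ)` of Goodman–Wallach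
(4.6)/(5.54) is defined over `ℚ`. [cite: Milne1999LefschetzClasses, §5 p. 665 (proof of Thm. 5.9)]
[cite: VoisinHodgeI2002, Ch. 7 introduction (p. 131)] [cite: GoodmanWallachGTM255, §5.5.1 Cor. 5.5.9 (5.54)] -/
theorem isotypicProj_mem_rationalEnd (hη : IsNSForm Φ η) (hnd : ∀ v : E, v ≠ 0 → ∃ w : E, η ![v, w] ≠ 0)
    {a : ℕ} (ha : a ≤ finrank ℂ E) : isotypicProj η a ∈ rationalEnd Φ := by
  intro w hw
  rw [mem_rationalFormsG_iff] at hw ⊢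
  exact isotypicProj_apply_mem_rationalForms Φ hη hnd ha hw

/-- **`P_a` maps `H^m(X; ℚ) ∩ H^{p,p}` into itself** (`P_a` is rational of bidegree `(0,0)`).
[cite: VoisinHodgeI2002, §6.2.3 Rem. 6.27; §7.1.2] [cite: GoodmanWallachGTM255, §5.5.1 Cor. 5.5.9 (5.54)] -/
theorem isotypicProj_apply_mem_hodgeClassesIn (hη : IsNSForm Φ η) (hnd : ∀ v : E, v ≠ 0 → ∃ w : E, η ![v, w] ≠ 0)
    {a : ℕ} (ha : a ≤ finrank ℂ E) {m p : ℕ} {γ : E [⋀^Fin m]→L[ℝ] ℂ} (hγ : γ ∈ hodgeClassesIn Φ m p) :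
    isotypicProj η a (of m γ) m ∈ hodgeClassesIn Φ m p := by
  rw [isotypicProj_eq_sum_single_single_smul_primitiveProj hnd ha]
  simp only [pi_single_one_eq_ratCast']
  exact sum_single_smul_primitiveProj_apply_mem_hodgeClassesIn Φ hη hnd _ hγ

/-- **`P_a` maps the `ℚ`-space of all Hodge classes into itself**: `H^{2•}_Hodge(X) = ⊕ₐ P_a H^{2•}_Hodge(X)`.
[cite: VoisinHodgeI2002, Ch. 7 introduction (p. 131); §7.1.2] [cite: Milne1999LefschetzClasses, §5 p. 665 (proof of Thm. 5.9)] -/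
theorem isotypicProj_apply_mem_hodgeClassesG (hη : IsNSForm Φ η) (hnd : ∀ v : E, v ≠ 0 → ∃ w : E, η ![v, w] ≠ 0)
    {a : ℕ} (ha : a ≤ finrank ℂ E) {w : GForm E ℂ} (hw : w ∈ hodgeClassesG Φ) :
    isotypicProj η a w ∈ hodgeClassesG Φ := by
  rw [isotypicProj_eq_sum_single_single_smul_primitiveProj hnd ha]
  simp only [pi_single_one_eq_ratCast']
  exact sum_single_smul_primitiveProj_apply_mem_hodgeClassesG Φ hη hnd _ hw

/-- **`P_a(Hdg(X)) ⊆ Hdg(X)`** — the isotypic projections stabilise Looijenga–Lunts' Hodge algebra: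
`Hdg(X) = ⊕ₐ P_a Hdg(X)`, the `(Sp(E, η), 𝔰𝔩₂)`-isotypic decomposition restricted to the Hodge algebra.
[cite: LooijengaLunts1997, §3 p. 16] [cite: VoisinHodgeI2002, §6.2.3 Rem. 6.27; §7.1.2] -/
theorem isotypicProj_mem_hodgeAlgebraEnd (hη : IsNSForm Φ η) (hnd : ∀ v : E, v ≠ 0 → ∃ w : E, η ![v, w] ≠ 0)
    {a : ℕ} (ha : a ≤ finrank ℂ E) : isotypicProj η a ∈ hodgeAlgebraEnd Φ := by
  rw [isotypicProj_eq_sum_single_single_smul_primitiveProj hnd ha]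
  simp only [pi_single_one_eq_ratCast']
  exact sum_single_smul_primitiveProj_mem_hodgeAlgebraEnd Φ hη hnd _

/-- **`P_a ∈ 𝔤𝔩(H•(X; ℚ)) ∩ Stab(Hdg(X))`**, both memberships at once (the form consumed with the Néron–Severi Lie
algebra `𝔤_NS(X) ⊆ rationalEnd Φ ⊓ hodgeAlgebraEnd Φ` of A1-60). [cite: LooijengaLunts1997, §1 (1.7); §3 p. 16] -/
theorem isotypicProj_mem_rationalEnd_and_mem_hodgeAlgebraEnd (hη : IsNSForm Φ η)
    (hnd : ∀ v : E, v ≠ 0 → ∃ w : E, η ![v, w] ≠ 0) {a : ℕ} (ha : a ≤ finrank ℂ E) :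
    isotypicProj η a ∈ rationalEnd Φ ∧ isotypicProj η a ∈ hodgeAlgebraEnd Φ :=
  ⟨isotypicProj_mem_rationalEnd Φ hη hnd ha, isotypicProj_mem_hodgeAlgebraEnd Φ hη hnd ha⟩

/-- **The Hodge algebra is the direct sum of its isotypic pieces**: for `w ∈ Hdg(X)`, `w = Σ_{a ≤ g} P_a w` with every
`P_a w ∈ Hdg(X)` (`Σₐ P_a = 1`, g22-#2 `sum_isotypicProj_apply`). [cite: LooijengaLunts1997, §3 p. 16]
[cite: GoodmanWallachGTM255, §4.1.6 Prop. 4.1.15 (4.6); §5.5.1 Cor. 5.5.9 (5.54)] -/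
theorem eq_sum_isotypicProj_of_mem_hodgeAlgebraG (hη : IsNSForm Φ η) (hnd : ∀ v : E, v ≠ 0 → ∃ w : E, η ![v, w] ≠ 0)
    {w : GForm E ℂ} (hw : w ∈ hodgeAlgebraG Φ) :
    w = ∑ a : Fin (finrank ℂ E + 1), isotypicProj η (a : ℕ) w ∧
      ∀ a : Fin (finrank ℂ E + 1), isotypicProj η (a : ℕ) w ∈ hodgeAlgebraG Φ :=
  ⟨(sum_isotypicProj_apply hnd w).symm, fun a ↦
    isotypicProj_mem_hodgeAlgebraEnd Φ hη hnd (Nat.lt_succ_iff.mp a.isLt) w hw⟩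

end Isotypic

end ComplexTorus

end Literature.Geometry.Kaehler
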